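import Literature.NumberTheory.DiophantineGeometry.FunctionFieldEulerCharacteristicCover
import Literature.NumberTheory.DiophantineGeometry.BelyiGaloisHurwitz
import Mathlib.FieldTheory.Galois.Basic
import HarnessLib

/-!
# Hurwitz's automorphism bound, Galois form: `[F : F₀] ≤ 84 (g - 1)`

Topic `NumberTheory/DiophantineGeometry`; sequel of `BelyiGaloisHurwitz.lean` (the case
`F₀ = K(f)`, `f` a Belyi function) and `HurwitzSignatureBound.lean` (the arithmetic). Hurwitz's
theorem (Math. Ann. 41, 1893): a curve of genus `g ≥ 2` over an algebraically closed field of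
characteristic `0` has at most `84(g - 1)` automorphisms; precisely, every finite group `G` of
automorphisms has `|G| = [F : F^G] ≤ 84(g - 1)` for the function field `F`. We prove:

* `finrank_le_of_isGalois_of_two_le_genus` — **for function fields `F ⊇ F₀ ⊇ K` of characteristic
  `0` with all places rational and `K` the full constant field of both, `F/F₀` Galois and
  `g(F) ≥ 2`: `[F : F₀] ≤ 84 (g(F) - 1)`;**
* `IntermediateField.finrank_le_of_isGalois_of_two_le_genus` — the same for an intermediate field
  `F₀` of `F/K` with `F/F₀` finite Galois, `K` algebraically closed (using
  `IsAlgFunctionField.of_intermediateField`: an intermediate field of finite index in a function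
  field is a function field);
* `card_le_of_faithfulSMul_of_two_le_genus`, `card_subgroup_algEquiv_le_of_two_le_genus` —
  **Hurwitz's theorem: `|G| ≤ 84 (g - 1)`** for a finite group `G` acting faithfully on `F` by
  `K`-algebra automorphisms, resp. a finite subgroup of `F ≃ₐ[K] F` (`K` algebraically closed of
  characteristic `0`, `g ≥ 2`), through `F₀ = F^G` (Artin: `[F : F^G] = |G|`, `F/F^G` Galois —
  Mathlib's `FixedPoints.finrank_eq_card`, `IsGalois.of_fixed_field`).

Ingredients, all proved here or in the tree:

1. `PlaceOver.exists_comapAlgEquiv_eq_of_restrict_eq` — **`Gal(F/F₀)` is transitive on the places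
   above a place `P₀` of `F₀`** (Stichtenoth Thm. 3.7.1; classical proof by weak approximation
   `PlaceOver.weakApproximation` and the norm `N(x) = ∏_σ σ(x)`, Mathlib's
   `Algebra.norm_eq_prod_automorphisms`, with `ord_P(z) = e(P|P₀) ord_{P₀}(z)` for `z ∈ F₀`,
   `PlaceOver.ord_algebraMap_eq_mul`); transport of places `PlaceOver.comapAlgEquiv` from
   `BelyiGaloisHurwitz.lean`, compatibility with `restrict` (`PlaceOver.restrict_comapAlgEquiv`);
2. `PlaceOver.card_fibre_mul_eq_finrank_of_isGalois` — hence constant ramification on a fibre and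
   **`#{P | P₀} · e_{P₀} = [F : F₀]`** (Cor. 3.7.2, with the fundamental equality
   `sum_ramification_eq_finrank` of `FunctionFieldEulerCharacteristicCover`); without rationality:
   `PlaceOver.degree_comapAlgEquiv` (transport preserves degrees) and
   `PlaceOver.card_fibre_mul_mul_degree_eq_of_isGalois` — **`r · e · D = [F : F₀] · deg P₀`** with
   `e` and `D = deg P` constant on the fibre (`r e f = n`);
3. the Riemann–Hurwitz formula in the tower, in the form derived in
   `FunctionFieldEulerCharacteristicCover.card_add_genus_ge_mul_of_cover` (same computation, kept as
   an equality): `2g - 2 = d(2g₀ - 2) + Σ_{P₀ ∈ T₀} (d - #{P | P₀})` for a finite set `T₀` of places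
   of `F₀` outside of which `y ∈ F₀ ∖ K` and its fibres are unramified (`finsum_diffOrd_eq`,
   `diffOrd_algebraMap_add_one`); exposed as theorems: `two_mul_genus_sub_two_eq_of_cover` (any
   finite `T₀` outside of which `F/F₀` is unramified) and, for Galois covers,
   `two_mul_genus_sub_two_eq_of_isGalois`: **`2g - 2 = d (2g₀ - 2 + Σ_{P₀ ∈ T₀} (1 - 1/e_{P₀}))`**;
4. so `2g - 2 = d (2g₀ - 2 + Σ_{P₀ ∈ T₀} (1 - 1/e_{P₀}))`, and
   `HurwitzSignatureBound.card_le_of_riemannHurwitz_signature` gives `d ≤ 84(g - 1)`.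

Not here: the finiteness of `Aut_K(F)` itself for `g ≥ 2` (Schmid), so the group form is stated for
finite groups. Theorems only; no definition, no named fact.

## References

* A. Hurwitz, *Über algebraische Gebilde mit eindeutigen Transformationen in sich*, Math. Ann. 41
  (1893), 403–442.
* H. Stichtenoth, *Algebraic Function Fields and Codes*, 2nd ed., GTM 254 (2009): Thm. 1.3.1,
  Thm. 3.1.11, Thm. 3.4.13, Lemma 3.5.2, Thm. 3.7.1, Cor. 3.7.2. [Stichtenoth2009]
* A. Javanpeykar, *Polynomial bounds for Arakelov invariants of Belyi curves*, Algebra & Number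
  Theory 8 (2014), §1.5 ("the Belyi degree of a Galois Belyi curve is bounded by the cardinality of
  its automorphism group"). [Javanpeykar2014]
-/

noncomputable section

open scoped Classical IntermediateField
open Finset

namespace Literature.NumberTheory.DiophantineGeometry.AlgFunctionField

universe u v

variable {K : Type u} [Field K]

section tower

variable {F₀ : Type v} {F : Type v} [Field F₀] [Field F] [Algebra K F₀] [Algebra K F] [Algebra F₀ F]
  [IsScalarTower K F₀ F] [IsAlgFunctionField K F₀] [FiniteDimensional F₀ F] [IsAlgFunctionField K F]

namespace PlaceOver

/-- Transport along an `F₀`-automorphism does not change the place of `F₀` below. [folklore] -/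
theorem restrict_comapAlgEquiv (σ : F ≃ₐ[F₀] F) (P : PlaceOver K F) :
    (P.comapAlgEquiv (σ.restrictScalars K)).restrict (K := K) (F := F₀) =
      P.restrict (K := K) (F := F₀) := by
  apply PlaceOver.ext
  ext x
  change (σ.restrictScalars K) (algebraMap F₀ F x) ∈ P.toValuationSubring ↔
    algebraMap F₀ F x ∈ P.toValuationSubring
  rw [AlgEquiv.restrictScalars_apply, AlgEquiv.commutes]

omit [IsAlgFunctionField K F₀] [FiniteDimensional F₀ F] in
/-- The ramification index is constant along a Galois orbit: `e(σ⁻¹P | P₀) = e(P | P₀)`.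
[folklore] -/
theorem ord_comapAlgEquiv_algebraMap (σ : F ≃ₐ[F₀] F) (P : PlaceOver K F) (z : F₀) :
    (P.comapAlgEquiv (σ.restrictScalars K)).ord (algebraMap F₀ F z) =
      P.ord (algebraMap F₀ F z) := by
  rw [ord_comapAlgEquiv, AlgEquiv.restrictScalars_apply, AlgEquiv.commutes]

/-- **The Galois group is transitive on the places above `P₀`** (Stichtenoth Thm. 3.7.1): for
`F/F₀` Galois and places `P, P'` of `F` above the place `P₀` of `F₀`, `P' = σ⁻¹(P)` for some
`σ ∈ Gal(F/F₀)`. Classical proof: otherwise weak approximation gives `x` of order `1` at `P'` and a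
unit at the other places above `P₀`; the norm `y = ∏_σ σ(x) ∈ F₀` then has `ord_P y = 0`, so
`ord_{P₀} y = 0`, so `ord_{P'} y = 0` — but `ord_{P'} y ≥ ord_{P'} x = 1`.
[cite: Stichtenoth2009, Thm. 3.7.1] -/
theorem exists_comapAlgEquiv_eq_of_restrict_eq [IsGalois F₀ F] (P₀ : PlaceOver K F₀)
    {P P' : PlaceOver K F} (hP : P.restrict (K := K) (F := F₀) = P₀)
    (hP' : P'.restrict (K := K) (F := F₀) = P₀) :
    ∃ σ : F ≃ₐ[F₀] F, P.comapAlgEquiv (σ.restrictScalars K) = P' := by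
  by_contra hne
  push Not at hne
  -- the fibre `U` over `P₀`
  set U : Finset (PlaceOver K F) := (P₀.finite_setOf_restrict_eq (F' := F)).toFinset with hU
  have hmemU : ∀ Q : PlaceOver K F, Q ∈ U ↔ Q.restrict (K := K) (F := F₀) = P₀ := fun Q ↦
    P₀.mem_toFinset_restrict_eq_iff Q
  -- `x`: order `1` at `P'`, a unit `≡ 1` at the other places above `P₀`
  obtain ⟨x, hx⟩ := PlaceOver.weakApproximation U (fun Q ↦ if Q = P' then 0 else 1) (fun _ ↦ 1)
  have hxP' : x ≠ 0 ∧ P'.ord x = 1 := by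
    have h := hx P' ((hmemU P').2 hP')
    simp only [if_true, sub_zero] at h
    exact h
  have hxQ : ∀ Q ∈ U, Q ≠ P' → Q.ord x = 0 := by
    intro Q hQ hQP'
    have h := hx Q hQ
    rw [if_neg hQP'] at h
    have h1 : Q.ord (1 : F) < Q.ord (x - 1) := by rw [PlaceOver.ord_one, h.2]; exact zero_lt_one
    have h2 := Q.ord_add_eq_left_of_lt one_ne_zero h.1 h1
    rw [add_sub_cancel] at h2
    rw [h2.2, PlaceOver.ord_one]
  have hxQ' : ∀ Q ∈ U, 0 ≤ Q.ord x := by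
    intro Q hQ
    rcases eq_or_ne Q P' with rfl | hQP'
    · rw [hxP'.2]; exact zero_le_one
    · rw [hxQ Q hQ hQP']
  -- the norm `y = ∏_σ σ x = N(x) ∈ F₀`
  set y : F := ∏ σ : F ≃ₐ[F₀] F, σ x with hy
  have hyN : y = algebraMap F₀ F (Algebra.norm F₀ x) := by
    rw [Algebra.norm_eq_prod_automorphisms]
  have hσx : ∀ σ : F ≃ₐ[F₀] F, σ x ≠ 0 := fun σ ↦ (_root_.map_ne_zero σ).2 hxP'.1
  have hcomapU : ∀ (Q : PlaceOver K F) (σ : F ≃ₐ[F₀] F), Q ∈ U →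
      Q.comapAlgEquiv (σ.restrictScalars K) ∈ U := by
    intro Q σ hQ
    rw [hmemU] at hQ ⊢
    rw [restrict_comapAlgEquiv, hQ]
  -- `ord_P y = 0`
  have hPy : P.ord y = 0 := by
    rw [hy, P.ord_prod_eq_sum _ _ fun σ _ ↦ hσx σ]
    refine Finset.sum_eq_zero fun σ _ ↦ ?_
    rw [show P.ord (σ x) = (P.comapAlgEquiv (σ.restrictScalars K)).ord x from
      (ord_comapAlgEquiv (σ.restrictScalars K) P x).symm]
    exact hxQ _ (hcomapU P σ ((hmemU P).2 hP)) (hne σ)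
  -- `ord_{P'} y ≥ 1`
  have hP'y : 1 ≤ P'.ord y := by
    rw [hy, P'.ord_prod_eq_sum _ _ fun σ _ ↦ hσx σ,
      ← Finset.add_sum_erase _ _ (Finset.mem_univ (1 : F ≃ₐ[F₀] F))]
    have h1 : P'.ord ((1 : F ≃ₐ[F₀] F) x) = 1 := by rw [AlgEquiv.one_apply, hxP'.2]
    rw [h1]
    have h2 : 0 ≤ ∑ σ ∈ (Finset.univ.erase (1 : F ≃ₐ[F₀] F)), P'.ord (σ x) := by
      refine Finset.sum_nonneg fun σ _ ↦ ?_
      rw [show P'.ord (σ x) = (P'.comapAlgEquiv (σ.restrictScalars K)).ord x from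
        (ord_comapAlgEquiv (σ.restrictScalars K) P' x).symm]
      exact hxQ' _ (hcomapU P' σ ((hmemU P').2 hP'))
    linarith
  -- `ord_P y = e(P|P₀) ord_{P₀} N(x)` and `ord_{P'} y = e(P'|P₀) ord_{P₀} N(x)`
  have hPe := P.ord_algebraMap_eq_mul (K := K) (Algebra.norm F₀ x)
  have hP'e := P'.ord_algebraMap_eq_mul (K := K) (Algebra.norm F₀ x)
  rw [← hyN] at hPe hP'e
  rw [hP] at hPe
  rw [hP'] at hP'e
  have he : 1 ≤ P.ord (algebraMap F₀ F (P₀.uniformizer : F₀)) := by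
    have := P.one_le_ord_algebraMap_uniformizer (K := K) (F := F₀)
    rwa [hP] at this
  have h0 : P₀.ord (Algebra.norm F₀ x) = 0 := by
    rw [hPy] at hPe
    rcases mul_eq_zero.1 hPe.symm with h | h
    · exact absurd h (by linarith)
    · exact h
  rw [h0, mul_zero] at hP'e
  linarith

/-- **A Galois fibre: `n · e = [F : F₀]`.** For `F/F₀` Galois with all places rational, the places
above `P₀` all have the same ramification index `e ≥ 1`, and their number `n` satisfies
`n · e = [F : F₀]` (Stichtenoth Cor. 3.7.2 with the fundamental equality Thm. 3.1.11).
[cite: Stichtenoth2009, Cor. 3.7.2] -/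
theorem card_fibre_mul_eq_finrank_of_isGalois [IsGalois F₀ F]
    (hrat₀ : ∀ P₀ : PlaceOver K F₀, P₀.IsRational) (hrat : ∀ P : PlaceOver K F, P.IsRational)
    (P₀ : PlaceOver K F₀) :
    ∃ e : ℕ, 0 < e ∧
      (∀ P ∈ (P₀.finite_setOf_restrict_eq (F' := F)).toFinset,
        P.ord (algebraMap F₀ F (P₀.uniformizer : F₀)) = e) ∧
      (((P₀.finite_setOf_restrict_eq (F' := F)).toFinset.card : ℤ)) * e = Module.finrank F₀ F := by
  set U := (P₀.finite_setOf_restrict_eq (F' := F)).toFinset with hU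
  have hmemU : ∀ Q : PlaceOver K F, Q ∈ U ↔ Q.restrict (K := K) (F := F₀) = P₀ := fun Q ↦
    P₀.mem_toFinset_restrict_eq_iff Q
  have hsum := sum_ramification_eq_finrank (K := K) (F := F) hrat₀ hrat P₀
  have hd : 0 < Module.finrank F₀ F := Module.finrank_pos
  obtain ⟨P₁, hP₁⟩ : U.Nonempty := by
    rw [Finset.nonempty_iff_ne_empty]
    intro h
    rw [← hU, h, Finset.sum_empty] at hsum
    exact absurd hsum (by exact_mod_cast hd.ne)
  have hP₁' := (hmemU P₁).1 hP₁
  have hall : ∀ P ∈ U, P.ord (algebraMap F₀ F (P₀.uniformizer : F₀)) =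
      P₁.ord (algebraMap F₀ F (P₀.uniformizer : F₀)) := by
    intro P hP
    obtain ⟨σ, rfl⟩ := exists_comapAlgEquiv_eq_of_restrict_eq P₀ hP₁' ((hmemU P).1 hP)
    exact ord_comapAlgEquiv_algebraMap σ P₁ _
  have he₁ : 1 ≤ P₁.ord (algebraMap F₀ F (P₀.uniformizer : F₀)) := by
    have := P₁.one_le_ord_algebraMap_uniformizer (K := K) (F := F₀)
    rwa [hP₁'] at this
  refine ⟨(P₁.ord (algebraMap F₀ F (P₀.uniformizer : F₀))).toNat, by omega, fun P hP ↦ ?_, ?_⟩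
  · rw [hall P hP, Int.toNat_of_nonneg (by omega)]
  · rw [Int.toNat_of_nonneg (by omega), ← hsum, hU, Finset.sum_congr rfl hall, Finset.sum_const,
      nsmul_eq_mul]

/-! #### Degrees are constant on Galois fibres; `r · e · f = n` -/

omit [IsAlgFunctionField K F₀] [FiniteDimensional F₀ F] in
/-- **Transport preserves the degree**: `deg σ⁻¹(P) = deg P` (`σ` induces a `K`-isomorphism of the
residue fields). [cite: Stichtenoth2009, Lemma 3.5.2] -/
theorem degree_comapAlgEquiv (σ : F ≃ₐ[K] F) (P : PlaceOver K F) :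
    (P.comapAlgEquiv σ).degree = P.degree := by
  set P' := P.comapAlgEquiv σ with hP'
  -- the ring isomorphism `σ : σ⁻¹(𝒪_P) ≃ 𝒪_P`
  let eqv : P'.toValuationSubring ≃+* P.toValuationSubring :=
    { toFun := fun y => ⟨σ (y : F), y.2⟩
      invFun := fun y => ⟨σ.symm (y : F), by
        change σ (σ.symm (y : F)) ∈ P.toValuationSubring
        rw [AlgEquiv.apply_symm_apply]; exact y.2⟩
      left_inv := fun y => Subtype.ext (σ.symm_apply_apply (y : F))
      right_inv := fun y => Subtype.ext (σ.apply_symm_apply (y : F))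
      map_mul' := fun y z => Subtype.ext (map_mul σ (y : F) z)
      map_add' := fun y z => Subtype.ext (map_add σ (y : F) z) }
  -- the induced isomorphism of residue fields is `K`-linear
  let ψ := IsLocalRing.ResidueField.mapEquiv eqv
  have hψres : ∀ y : P'.toValuationSubring,
      ψ (IsLocalRing.residue _ y) = IsLocalRing.residue _ (eqv y) := fun y ↦ by
    simp only [ψ, IsLocalRing.ResidueField.mapEquiv_apply, IsLocalRing.ResidueField.map_residue]
    rfl
  have heqvK : ∀ c : K, eqv (algebraMap K P'.toValuationSubring c) =
      algebraMap K P.toValuationSubring c := fun c ↦ by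
    apply Subtype.ext
    change σ (algebraMap K F c) = algebraMap K F c
    exact σ.commutes c
  have hψ : ∀ (c : K) (x : P'.residueField), ψ (c • x) = c • ψ x := by
    intro c x
    obtain ⟨x, rfl⟩ := IsLocalRing.residue_surjective x
    rw [Algebra.smul_def, Algebra.smul_def, PlaceOver.algebraMap_residueField_apply,
      PlaceOver.algebraMap_residueField_apply, ← map_mul, hψres, hψres, ← map_mul, map_mul eqv,
      heqvK]
  let ψₗ : P'.residueField ≃ₗ[K] P.residueField :=
    { ψ with map_smul' := hψ }
  exact ψₗ.finrank_eq

/-- **A Galois fibre in general: `r · e · f = n`.** For `F/F₀` Galois and a place `P₀` of `F₀`, the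
places above `P₀` all have the same ramification index `e` and the same degree `D = f · deg P₀`,
and `r · e · D = [F : F₀] · deg P₀` where `r` is their number (Stichtenoth Cor. 3.7.2 with the
fundamental equality Thm. 3.1.11; no rationality hypothesis). [cite: Stichtenoth2009, Cor. 3.7.2] -/
theorem card_fibre_mul_mul_degree_eq_of_isGalois [IsGalois F₀ F] (P₀ : PlaceOver K F₀) :
    ∃ e D : ℕ, 0 < e ∧
      (∀ P ∈ (P₀.finite_setOf_restrict_eq (F' := F)).toFinset,
        P.ord (algebraMap F₀ F (P₀.uniformizer : F₀)) = e ∧ P.degree = D) ∧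
      (P₀.finite_setOf_restrict_eq (F' := F)).toFinset.card * e * D =
        Module.finrank F₀ F * P₀.degree := by
  set U := (P₀.finite_setOf_restrict_eq (F' := F)).toFinset with hU
  have hmemU : ∀ Q : PlaceOver K F, Q ∈ U ↔ Q.restrict (K := K) (F := F₀) = P₀ := fun Q ↦
    P₀.mem_toFinset_restrict_eq_iff Q
  have hsum := P₀.sum_ramification_mul_degree_eq (F' := F) U hmemU
  obtain ⟨P₁, hP₁'⟩ := P₀.exists_restrict_eq' (F' := F)
  have hP₁ : P₁ ∈ U := (hmemU P₁).2 hP₁'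
  have hall : ∀ P ∈ U, P.ord (algebraMap F₀ F (P₀.uniformizer : F₀)) =
      P₁.ord (algebraMap F₀ F (P₀.uniformizer : F₀)) ∧ P.degree = P₁.degree := by
    intro P hP
    obtain ⟨σ, rfl⟩ := exists_comapAlgEquiv_eq_of_restrict_eq P₀ hP₁' ((hmemU P).1 hP)
    exact ⟨ord_comapAlgEquiv_algebraMap σ P₁ _, degree_comapAlgEquiv _ _⟩
  have he₁ : 1 ≤ P₁.ord (algebraMap F₀ F (P₀.uniformizer : F₀)) := by
    have := P₁.one_le_ord_algebraMap_uniformizer (K := K) (F := F₀)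
    rwa [hP₁'] at this
  refine ⟨(P₁.ord (algebraMap F₀ F (P₀.uniformizer : F₀))).toNat, P₁.degree, by omega,
    fun P hP ↦ ⟨by rw [(hall P hP).1, Int.toNat_of_nonneg (by omega)], (hall P hP).2⟩, ?_⟩
  have h : ∑ P ∈ U, P.ord (algebraMap F₀ F (P₀.uniformizer : F₀)) * (P.degree : ℤ) =
      U.card * (P₁.ord (algebraMap F₀ F (P₀.uniformizer : F₀)) * (P₁.degree : ℤ)) := by
    rw [Finset.sum_congr rfl fun P hP ↦ by rw [(hall P hP).1, (hall P hP).2], Finset.sum_const,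
      nsmul_eq_mul]
  have h' : ((U.card * (P₁.ord (algebraMap F₀ F (P₀.uniformizer : F₀))).toNat * P₁.degree : ℕ) : ℤ)
      = Module.finrank F₀ F * (P₀.degree : ℤ) := by
    push_cast
    rw [Int.toNat_of_nonneg (by omega), ← hsum, h]
    ring
  exact_mod_cast h'

end PlaceOver

/-! ### Hurwitz's bound -/

variable [IsIntegrallyClosedIn K F₀] [IsIntegrallyClosedIn K F] [CharZero K]

/-- **The Riemann–Hurwitz formula for a tame cover with rational places (equality form).** Let
`F ⊇ F₀ ⊇ K` be function fields of characteristic `0` with all places rational and `K` the full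
constant field of both, `d = [F : F₀]`, and `T₀` a finite set of places of `F₀` outside of which
`F/F₀` is unramified (`e(P|P₀) = 1` for all `P` above `P₀ ∉ T₀`). Then
`2g - 2 = d (2g₀ - 2) + Σ_{P₀ ∈ T₀} (d - #{P | P₀})`
(`deg Diff(F/F₀) = Σ_P (e_P - 1) = Σ_{P₀} (d - r_{P₀})` in the tame case). The computation is the
one of `FunctionFieldEulerCharacteristicCover.card_add_genus_ge_mul_of_cover`
(`finsum_diffOrd_eq` up- and downstairs for some `y ∈ F₀ ∖ K`, `diffOrd_algebraMap_add_one`,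
`sum_ramification_eq_finrank`).
[cite: Stichtenoth2009, Thm. 3.4.13 with Cor. 3.5.5] -/
theorem two_mul_genus_sub_two_eq_of_cover (hrat₀ : ∀ P₀ : PlaceOver K F₀, P₀.IsRational)
    (hrat : ∀ P : PlaceOver K F, P.IsRational) (T₀ : Finset (PlaceOver K F₀))
    (hT₀ : ∀ P : PlaceOver K F, P.restrict (K := K) (F := F₀) ∉ T₀ →
      P.ord (algebraMap F₀ F ((P.restrict (K := K) (F := F₀)).uniformizer : F₀)) = 1) :
    (2 * genus K F - 2 : ℤ) =
      Module.finrank F₀ F * (2 * genus K F₀ - 2) +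
        ∑ P₀ ∈ T₀, ((Module.finrank F₀ F : ℤ) -
          ((P₀.finite_setOf_restrict_eq (F' := F)).toFinset.card : ℤ)) := by
  -- a non-constant `y ∈ F₀`
  obtain ⟨y, hyt⟩ := IsAlgFunctionField.exists_transcendental (K := K) (F := F₀)
  have hy : y ∉ Set.range (algebraMap K F₀) := by
    rintro ⟨c, rfl⟩
    exact hyt (isAlgebraic_algebraMap c)
  set d : ℤ := (Module.finrank F₀ F : ℤ) with hd
  set y' : F := algebraMap F₀ F y with hy'
  have hy'K : y' ∉ Set.range (algebraMap K F) := by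
    rintro ⟨c, hc⟩
    apply hy
    refine ⟨c, (algebraMap F₀ F).injective ?_⟩
    rw [← IsScalarTower.algebraMap_apply, hc]
  set fib : PlaceOver K F₀ → Finset (PlaceOver K F) :=
    fun P₀ ↦ (P₀.finite_setOf_restrict_eq (F' := F)).toFinset with hfib
  have hmemfib : ∀ P₀ P, P ∈ fib P₀ ↔ P.restrict (K := K) (F := F₀) = P₀ := fun P₀ P ↦
    P₀.mem_toFinset_restrict_eq_iff P
  have hdisj : ∀ (T : Finset (PlaceOver K F₀)),
      (T : Set (PlaceOver K F₀)).PairwiseDisjoint fib := by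
    intro T P₀ _ Q₀ _ hne
    rw [Function.onFun, Finset.disjoint_left]
    intro P hP hQ
    exact hne (((hmemfib P₀ P).1 hP).symm.trans ((hmemfib Q₀ P).1 hQ))
  have hsume : ∀ P₀ : PlaceOver K F₀,
      ∑ P ∈ fib P₀, P.ord (algebraMap F₀ F (P₀.uniformizer : F₀)) = d :=
    fun P₀ ↦ sum_ramification_eq_finrank hrat₀ hrat P₀
  -- enlarge `T₀` by the places where `y` or its fibres ramify
  set R₀ : Finset (PlaceOver K F₀) := (differentialDivisor (dOf K y)).support with hR₀
  set R : Finset (PlaceOver K F) := (differentialDivisor (dOf K y')).support with hR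
  set T₁ : Finset (PlaceOver K F₀) :=
    T₀ ∪ (R₀ ∪ R.image (fun P ↦ P.restrict (K := K) (F := F₀))) with hT₁
  set T : Finset (PlaceOver K F) := T₁.biUnion fib with hT
  have hδ₀ : ∀ P₀, P₀ ∉ T₁ → P₀.diffOrd y = 0 := by
    intro P₀ hP₀
    rw [← differentialDivisor_dOf_apply hrat₀ hy P₀]
    by_contra h
    exact hP₀ (by simp [hT₁, hR₀, Finsupp.mem_support_iff.2 h])
  have hδ : ∀ P, P ∉ T → P.diffOrd y' = 0 := by
    intro P hP
    rw [← differentialDivisor_dOf_apply hrat hy'K P]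
    by_contra h
    apply hP
    rw [hT, Finset.mem_biUnion]
    refine ⟨P.restrict (K := K) (F := F₀), ?_, (hmemfib _ P).2 rfl⟩
    simp only [hT₁, Finset.mem_union, Finset.mem_image]
    exact Or.inr (Or.inr ⟨P, Finsupp.mem_support_iff.2 h, rfl⟩)
  have hRH₀ : ∑ P₀ ∈ T₁, P₀.diffOrd y = 2 * genus K F₀ - 2 := by
    rw [← finsum_diffOrd_eq hrat₀ hy, finsum_eq_sum_of_support_subset _ (s := T₁)]
    intro P₀ hP₀; by_contra h; exact hP₀ (hδ₀ P₀ h)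
  have hRH : ∑ P ∈ T, P.diffOrd y' = 2 * genus K F - 2 := by
    rw [← finsum_diffOrd_eq hrat hy'K, finsum_eq_sum_of_support_subset _ (s := T)]
    intro P hP; by_contra h; exact hP (hδ P h)
  have hfibre : ∀ P₀, ∑ P ∈ fib P₀, P.diffOrd y' = d * (P₀.diffOrd y + 1) - (fib P₀).card := by
    intro P₀
    have h1 : ∀ P ∈ fib P₀, P.diffOrd y' =
        P.ord (algebraMap F₀ F (P₀.uniformizer : F₀)) * (P₀.diffOrd y + 1) - 1 := by
      intro P hP
      have h := diffOrd_algebraMap_add_one (K := K) (F := F) hrat₀ P hy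
      rw [(hmemfib P₀ P).1 hP, ← hy'] at h
      linarith
    rw [Finset.sum_congr rfl h1, Finset.sum_sub_distrib, ← Finset.sum_mul, hsume P₀,
      Finset.sum_const, nsmul_eq_mul, mul_one]
  have hsplit : ∑ P ∈ T, P.diffOrd y' = ∑ P₀ ∈ T₁, ∑ P ∈ fib P₀, P.diffOrd y' := by
    rw [hT, Finset.sum_biUnion (hdisj T₁)]
  have hsplit' : ∑ P₀ ∈ T₁, ∑ P ∈ fib P₀, P.diffOrd y' =
      d * ∑ P₀ ∈ T₁, P₀.diffOrd y + ∑ P₀ ∈ T₁, (d - ((fib P₀).card : ℤ)) := by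
    rw [Finset.sum_congr rfl fun P₀ _ ↦ hfibre P₀, Finset.mul_sum, ← Finset.sum_add_distrib]
    exact Finset.sum_congr rfl fun P₀ _ ↦ by ring
  have hRHZ : (2 * genus K F - 2 : ℤ) =
      d * (2 * genus K F₀ - 2) + ∑ P₀ ∈ T₁, (d - ((fib P₀).card : ℤ)) := by
    rw [← hRH, hsplit, hsplit', hRH₀]
  -- the terms outside `T₀` vanish: full fibres
  have hfull : ∀ P₀, P₀ ∉ T₀ → ((fib P₀).card : ℤ) = d := by
    intro P₀ hP₀
    rw [← hsume P₀, Finset.card_eq_sum_ones, Nat.cast_sum]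
    refine Finset.sum_congr rfl fun P hP ↦ ?_
    have hPP₀ := (hmemfib P₀ P).1 hP
    have h1 := hT₀ P (by rwa [hPP₀])
    rw [hPP₀] at h1
    rw [h1, Nat.cast_one]
  rw [hRHZ, hT₁, ← Finset.union_sdiff_self_eq_union, Finset.sum_union Finset.disjoint_sdiff,
    Finset.sum_eq_zero (s := _ \ T₀) fun P₀ hP₀ ↦ by
      rw [hfull P₀ (Finset.mem_sdiff.1 hP₀).2, sub_self],
    add_zero]

/-- **The Riemann–Hurwitz formula for a Galois cover with rational places:**
`2g - 2 = [F : F₀] · (2g₀ - 2 + Σ_{P₀ ∈ T₀} (1 - 1/e_{P₀}))` for `F/F₀` Galois (characteristic `0`,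
all places rational), where `e_{P₀}` is the common ramification index above `P₀`
(`PlaceOver.card_fibre_mul_eq_finrank_of_isGalois`) and `T₀` is any finite set of places of `F₀`
outside of which `F/F₀` is unramified. [cite: Stichtenoth2009, Thm. 3.4.13 and Cor. 3.7.2] -/
theorem two_mul_genus_sub_two_eq_of_isGalois [IsGalois F₀ F]
    (hrat₀ : ∀ P₀ : PlaceOver K F₀, P₀.IsRational) (hrat : ∀ P : PlaceOver K F, P.IsRational)
    (T₀ : Finset (PlaceOver K F₀)) (e : PlaceOver K F₀ → ℕ)
    (he : ∀ P : PlaceOver K F,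
      P.ord (algebraMap F₀ F ((P.restrict (K := K) (F := F₀)).uniformizer : F₀)) =
        e (P.restrict (K := K) (F := F₀)))
    (hT₀ : ∀ P₀, P₀ ∉ T₀ → e P₀ = 1) :
    (2 * genus K F - 2 : ℚ) =
      Module.finrank F₀ F * (2 * genus K F₀ - 2 + ∑ P₀ ∈ T₀, (1 - 1 / (e P₀ : ℚ))) := by
  have hRH := two_mul_genus_sub_two_eq_of_cover (K := K) (F₀ := F₀) (F := F) hrat₀ hrat T₀
    (fun P hP ↦ by rw [he P, hT₀ _ hP, Nat.cast_one])
  -- `#{P | P₀} · e P₀ = d`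
  have hcard : ∀ P₀ : PlaceOver K F₀,
      (((P₀.finite_setOf_restrict_eq (F' := F)).toFinset.card : ℚ)) * e P₀ =
        Module.finrank F₀ F ∧ 0 < e P₀ := by
    intro P₀
    obtain ⟨e', he'0, he', hprod⟩ :=
      PlaceOver.card_fibre_mul_eq_finrank_of_isGalois (K := K) (F := F) hrat₀ hrat P₀
    obtain ⟨P₁, hP₁⟩ := P₀.exists_restrict_eq' (F' := F)
    have hee : e P₀ = e' := by
      have h1 := he' P₁ ((P₀.mem_toFinset_restrict_eq_iff P₁).2 hP₁)
      have h2 := he P₁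
      rw [hP₁] at h2
      rw [h2] at h1
      exact_mod_cast h1
    rw [hee]
    exact ⟨by exact_mod_cast hprod, he'0⟩
  have hterm : ∀ P₀, ((Module.finrank F₀ F : ℚ) -
      ((P₀.finite_setOf_restrict_eq (F' := F)).toFinset.card : ℚ)) =
        (Module.finrank F₀ F : ℚ) * (1 - 1 / (e P₀ : ℚ)) := by
    intro P₀
    obtain ⟨h, he0⟩ := hcard P₀
    have he' : (0 : ℚ) < e P₀ := by exact_mod_cast he0
    rw [← h]
    field_simp
  have hRHQ : (2 * (genus K F : ℚ) - 2) = (Module.finrank F₀ F : ℚ) * (2 * (genus K F₀ : ℚ) - 2) +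
      ∑ P₀ ∈ T₀, ((Module.finrank F₀ F : ℚ) -
        ((P₀.finite_setOf_restrict_eq (F' := F)).toFinset.card : ℚ)) := by
    have := hRH; exact_mod_cast this
  rw [hRHQ, Finset.sum_congr rfl fun P₀ _ ↦ hterm P₀, ← Finset.mul_sum]
  ring

/-- **Hurwitz's theorem, Galois form: `[F : F₀] ≤ 84 (g - 1)`.** Let `F ⊇ F₀ ⊇ K` be function
fields of characteristic `0` with all places rational and `K` the full constant field of both (e.g.
`K` algebraically closed), `F/F₀` Galois and `g = g(F) ≥ 2`. Then `[F : F₀] ≤ 84 (g - 1)`; for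
`F₀ = F^G` the fixed field of a finite group `G` of `K`-automorphisms this is Hurwitz's bound
`|G| ≤ 84(g - 1)` (Hurwitz 1893). Proof: the Riemann–Hurwitz formula in the tower
(`FunctionFieldEulerCharacteristicCover`: `2g - 2 = d(2g₀ - 2) + Σ_{P₀}(d - #{P | P₀})`), the Galois
fibre count `#{P | P₀} · e_{P₀} = d` (`PlaceOver.card_fibre_mul_eq_finrank_of_isGalois`), and
Hurwitz's
signature bound `2g₀ - 2 + Σ (1 - 1/e_{P₀}) ≥ 1/42` (`card_le_of_riemannHurwitz_signature`).
[cite: Stichtenoth2009, Thm. 3.7.1, Cor. 3.7.2, Thm. 3.4.13] -/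
theorem finrank_le_of_isGalois_of_two_le_genus [IsGalois F₀ F]
    (hrat₀ : ∀ P₀ : PlaceOver K F₀, P₀.IsRational)
    (hrat : ∀ P : PlaceOver K F, P.IsRational) (hg : 2 ≤ genus K F) :
    Module.finrank F₀ F ≤ 84 * (genus K F - 1) := by
  -- a non-constant `y ∈ F₀`
  obtain ⟨y, hyt⟩ := IsAlgFunctionField.exists_transcendental (K := K) (F := F₀)
  have hy : y ∉ Set.range (algebraMap K F₀) := by
    rintro ⟨c, rfl⟩
    exact hyt (isAlgebraic_algebraMap c)
  set d : ℤ := (Module.finrank F₀ F : ℤ) with hd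
  set y' : F := algebraMap F₀ F y with hy'
  have hy'K : y' ∉ Set.range (algebraMap K F) := by
    rintro ⟨c, hc⟩
    apply hy
    refine ⟨c, (algebraMap F₀ F).injective ?_⟩
    rw [← IsScalarTower.algebraMap_apply, hc]
  -- fibres of `restrict`
  set fib : PlaceOver K F₀ → Finset (PlaceOver K F) :=
    fun P₀ ↦ (P₀.finite_setOf_restrict_eq (F' := F)).toFinset with hfib
  have hmemfib : ∀ P₀ P, P ∈ fib P₀ ↔ P.restrict (K := K) (F := F₀) = P₀ := fun P₀ P ↦
    P₀.mem_toFinset_restrict_eq_iff P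
  have hdisj : ∀ (T₀ : Finset (PlaceOver K F₀)),
      (T₀ : Set (PlaceOver K F₀)).PairwiseDisjoint fib := by
    intro T₀ P₀ _ Q₀ _ hne
    rw [Function.onFun, Finset.disjoint_left]
    intro P hP hQ
    exact hne (((hmemfib P₀ P).1 hP).symm.trans ((hmemfib Q₀ P).1 hQ))
  have hsume : ∀ P₀ : PlaceOver K F₀,
      ∑ P ∈ fib P₀, P.ord (algebraMap F₀ F (P₀.uniformizer : F₀)) = d :=
    fun P₀ ↦ sum_ramification_eq_finrank hrat₀ hrat P₀
  -- a finite set `T₀` of places of `F₀` off which (and off whose fibres) `y` is unramified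
  set R₀ : Finset (PlaceOver K F₀) := (differentialDivisor (dOf K y)).support with hR₀
  set R : Finset (PlaceOver K F) := (differentialDivisor (dOf K y')).support with hR
  set T₀ : Finset (PlaceOver K F₀) := R₀ ∪ R.image (fun P ↦ P.restrict (K := K) (F := F₀)) with hT₀
  set T : Finset (PlaceOver K F) := T₀.biUnion fib with hT
  have hδ₀ : ∀ P₀, P₀ ∉ T₀ → P₀.diffOrd y = 0 := by
    intro P₀ hP₀
    rw [← differentialDivisor_dOf_apply hrat₀ hy P₀]
    by_contra h
    exact hP₀ (by simp [hT₀, hR₀, Finsupp.mem_support_iff.2 h])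
  have hδ : ∀ P, P ∉ T → P.diffOrd y' = 0 := by
    intro P hP
    rw [← differentialDivisor_dOf_apply hrat hy'K P]
    by_contra h
    apply hP
    rw [hT, Finset.mem_biUnion]
    refine ⟨P.restrict (K := K) (F := F₀), ?_, (hmemfib _ P).2 rfl⟩
    simp only [hT₀, Finset.mem_union, Finset.mem_image]
    exact Or.inr ⟨P, Finsupp.mem_support_iff.2 h, rfl⟩
  -- Riemann–Hurwitz downstairs and upstairs, as sums over `T₀` and `T`
  have hRH₀ : ∑ P₀ ∈ T₀, P₀.diffOrd y = 2 * genus K F₀ - 2 := by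
    rw [← finsum_diffOrd_eq hrat₀ hy, finsum_eq_sum_of_support_subset _ (s := T₀)]
    intro P₀ hP₀; by_contra h; exact hP₀ (hδ₀ P₀ h)
  have hRH : ∑ P ∈ T, P.diffOrd y' = 2 * genus K F - 2 := by
    rw [← finsum_diffOrd_eq hrat hy'K, finsum_eq_sum_of_support_subset _ (s := T)]
    intro P hP; by_contra h; exact hP (hδ P h)
  have hfibre : ∀ P₀, ∑ P ∈ fib P₀, P.diffOrd y' = d * (P₀.diffOrd y + 1) - (fib P₀).card := by
    intro P₀
    have h1 : ∀ P ∈ fib P₀, P.diffOrd y' =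
        P.ord (algebraMap F₀ F (P₀.uniformizer : F₀)) * (P₀.diffOrd y + 1) - 1 := by
      intro P hP
      have h := diffOrd_algebraMap_add_one (K := K) (F := F) hrat₀ P hy
      rw [(hmemfib P₀ P).1 hP, ← hy'] at h
      linarith
    rw [Finset.sum_congr rfl h1, Finset.sum_sub_distrib, ← Finset.sum_mul, hsume P₀,
      Finset.sum_const, nsmul_eq_mul, mul_one]
  have hsplit : ∑ P ∈ T, P.diffOrd y' = ∑ P₀ ∈ T₀, ∑ P ∈ fib P₀, P.diffOrd y' := by
    rw [hT, Finset.sum_biUnion (hdisj T₀)]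
  have hsplit' : ∑ P₀ ∈ T₀, ∑ P ∈ fib P₀, P.diffOrd y' =
      d * ∑ P₀ ∈ T₀, P₀.diffOrd y + ∑ P₀ ∈ T₀, (d - ((fib P₀).card : ℤ)) := by
    rw [Finset.sum_congr rfl fun P₀ _ ↦ hfibre P₀, Finset.mul_sum, ← Finset.sum_add_distrib]
    exact Finset.sum_congr rfl fun P₀ _ ↦ by ring
  -- `2g - 2 = d (2g₀ - 2) + Σ_{P₀ ∈ T₀} (d - n_{P₀})`
  have hRHZ : (2 * genus K F - 2 : ℤ) =
      d * (2 * genus K F₀ - 2) + ∑ P₀ ∈ T₀, (d - ((fib P₀).card : ℤ)) := by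
    rw [← hRH, hsplit, hsplit', hRH₀]
  -- Galois fibres: `n_{P₀} e_{P₀} = d`
  choose e he0 _ hne using
    fun P₀ : PlaceOver K F₀ ↦ PlaceOver.card_fibre_mul_eq_finrank_of_isGalois (K := K) (F := F)
      hrat₀ hrat P₀
  have hdq : ((d : ℤ) : ℚ) = (Module.finrank F₀ F : ℚ) := by rw [hd]; exact Int.cast_natCast _
  have hterm : ∀ P₀, ((d : ℚ) - ((fib P₀).card : ℚ)) =
      (Module.finrank F₀ F : ℚ) * (1 - 1 / (e P₀ : ℚ)) := by
    intro P₀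
    have he' : (0 : ℚ) < e P₀ := by exact_mod_cast he0 P₀
    have h' : ((fib P₀).card : ℚ) * (e P₀ : ℚ) = (Module.finrank F₀ F : ℚ) := by
      have := hne P₀; exact_mod_cast this
    rw [hdq, ← h']
    field_simp
  -- the signature `(g₀; e_{P₀} for P₀ ∈ T₀ with e ≥ 2)`
  set s : Finset (PlaceOver K F₀) := T₀.filter fun P₀ ↦ 2 ≤ e P₀ with hs
  have hsum : ∑ P₀ ∈ s, (1 - 1 / (e P₀ : ℚ)) = ∑ P₀ ∈ T₀, (1 - 1 / (e P₀ : ℚ)) := by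
    rw [hs]
    refine Finset.sum_filter_of_ne fun P₀ _ hne' ↦ ?_
    by_contra h
    have h1 : e P₀ = 1 := by have := he0 P₀; omega
    rw [h1] at hne'
    norm_num at hne'
  have hRHQ : (2 * (genus K F : ℚ) - 2) =
      (d : ℚ) * (2 * (genus K F₀ : ℚ) - 2) + ∑ P₀ ∈ T₀, ((d : ℚ) - ((fib P₀).card : ℚ)) := by
    have := hRHZ; exact_mod_cast this
  have hsig : (2 * (genus K F : ℚ) - 2) =
      (Module.finrank F₀ F : ℕ) * (2 * (genus K F₀ : ℚ) - 2 + ∑ P₀ ∈ s, (1 - 1 / (e P₀ : ℚ))) := by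
    rw [hRHQ, Finset.sum_congr rfl fun P₀ _ ↦ hterm P₀, ← Finset.mul_sum, hsum, hdq]
    ring
  exact card_le_of_riemannHurwitz_signature s e (genus K F₀)
    (fun P₀ hP₀ ↦ (Finset.mem_filter.1 hP₀).2) hg hsig

/-- **The Hurwitz equality case for function fields: `[F : F₀] = 84 (g - 1)` forces the signature
`(0; 2, 3, 7)`.** In the situation of `two_mul_genus_sub_two_eq_of_isGalois` (`F/F₀` Galois,
characteristic `0`, all places rational, `g(F) ≥ 2`), if `[F : F₀] = 84 (g - 1)` then `g(F₀) = 0`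
and exactly three places of `F₀` ramify in `F`, with ramification indices `{2, 3, 7}` (Hurwitz
groups are quotients of the `(2,3,7)` triangle group). [folklore] -/
theorem signature_of_finrank_eq [IsGalois F₀ F]
    (hrat₀ : ∀ P₀ : PlaceOver K F₀, P₀.IsRational) (hrat : ∀ P : PlaceOver K F, P.IsRational)
    (T₀ : Finset (PlaceOver K F₀)) (e : PlaceOver K F₀ → ℕ)
    (he : ∀ P : PlaceOver K F,
      P.ord (algebraMap F₀ F ((P.restrict (K := K) (F := F₀)).uniformizer : F₀)) =
        e (P.restrict (K := K) (F := F₀)))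
    (hT₀ : ∀ P₀, P₀ ∉ T₀ → e P₀ = 1) (hg : 2 ≤ genus K F)
    (hN : Module.finrank F₀ F = 84 * (genus K F - 1)) :
    genus K F₀ = 0 ∧ (T₀.filter fun P₀ ↦ 2 ≤ e P₀).card = 3 ∧
      (T₀.filter fun P₀ ↦ 2 ≤ e P₀).val.map e = {2, 3, 7} := by
  classical
  have hRH := two_mul_genus_sub_two_eq_of_isGalois (K := K) (F₀ := F₀) (F := F) hrat₀ hrat T₀ e
    he hT₀
  -- every `e P₀ ≥ 1`
  have he1 : ∀ P₀, 1 ≤ e P₀ := by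
    intro P₀
    obtain ⟨P, hP⟩ := P₀.exists_restrict_eq' (F' := F)
    have h1 := P.one_le_ord_algebraMap_uniformizer (K := K) (F := F₀)
    rw [he P, hP] at h1
    exact_mod_cast h1
  set s : Finset (PlaceOver K F₀) := T₀.filter fun P₀ ↦ 2 ≤ e P₀ with hs
  have hsum : ∑ P₀ ∈ s, (1 - 1 / (e P₀ : ℚ)) = ∑ P₀ ∈ T₀, (1 - 1 / (e P₀ : ℚ)) := by
    rw [hs]
    refine Finset.sum_filter_of_ne fun P₀ _ hne' ↦ ?_
    by_contra h
    have h1 : e P₀ = 1 := by have := he1 P₀; omega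
    rw [h1] at hne'
    norm_num at hne'
  rw [← hsum] at hRH
  exact signature_of_card_eq s e (genus K F₀) (fun P₀ hP₀ ↦ (Finset.mem_filter.1 hP₀).2) hg hRH hN

end tower

/-! ### The fixed field of a finite group, and Hurwitz's theorem `|G| ≤ 84(g - 1)` -/

section group

variable {F : Type v} [Field F] [Algebra K F]

/-- **An intermediate field of finite index in a function field is a function field.** If `F/K` is
an algebraic function field of one variable and `F₀` an intermediate field with `[F : F₀] < ∞`,
then `F₀/K` is an algebraic function field of one variable: `trdeg_K F₀ = trdeg_K F = 1`, and
`F₀` is finitely generated over `K` because it is a finite extension of `K(t)` for any `t ∈ F₀`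
transcendental over `K` (`[F : K(t)] < ∞`). [folklore] -/
theorem IsAlgFunctionField.of_intermediateField [IsAlgFunctionField K F]
    (F₀ : IntermediateField K F)
    [FiniteDimensional F₀ F] : IsAlgFunctionField K F₀ := by
  haveI : Algebra.IsAlgebraic F₀ F := Algebra.IsAlgebraic.of_finite F₀ F
  -- transcendence degree
  have htr : Algebra.trdeg K F₀ = 1 := by
    have h := trdeg_add_eq K F₀ (A := F)
    rw [trdeg_eq_zero (R := F₀) (A := F), add_zero,
      IsAlgFunctionField.trdeg_eq_one (K := K) (F := F)] at h
    exact h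
  -- a transcendental element of `F₀`
  obtain ⟨t, ht⟩ : ∃ t : F₀, Transcendental K t := by
    have h : Algebra.Transcendental K F₀ := (trdeg_ne_zero_iff (R := K) (A := F₀)).1 (by
      rw [htr]; exact one_ne_zero)
    exact h.transcendental
  have ht' : Transcendental K (t : F) := by
    exact (transcendental_algebraMap_iff (algebraMap F₀ F).injective).2 ht
  haveI := IsAlgFunctionField.finiteDimensional_adjoin_simple (K := K) (F := F) ht'
  -- `K(t) ≤ F₀`, and `F₀` is finite over `K(t)`, hence finitely generated over `K`
  have hle : K⟮(t : F)⟯ ≤ F₀ := IntermediateField.adjoin_simple_le_iff.2 t.2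
  set S : IntermediateField K⟮(t : F)⟯ F := IntermediateField.extendScalars hle with hS
  have hSfg : S.FG := IntermediateField.fg_of_noetherian S
  haveI h1 : Algebra.EssFiniteType K⟮(t : F)⟯ S := IntermediateField.essFiniteType_iff.2 hSfg
  haveI h2 : Algebra.EssFiniteType K K⟮(t : F)⟯ :=
    IntermediateField.essFiniteType_iff.2
      (IntermediateField.fg_adjoin_of_finite (Set.finite_singleton (t : F)))
  have h3 : Algebra.EssFiniteType K S := Algebra.EssFiniteType.comp K K⟮(t : F)⟯ S
  haveI : Algebra.EssFiniteType K F₀ := h3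
  exact ⟨htr, IntermediateField.fg_top K F₀⟩

/-- **Hurwitz, intermediate-field form.** For a function field `F/K` of genus `g ≥ 2` over an
algebraically closed field of characteristic `0` and an intermediate field `F₀` with `F/F₀` finite
Galois: `[F : F₀] ≤ 84 (g - 1)`. [cite: Stichtenoth2009, Thm. 3.7.1] -/
theorem IntermediateField.finrank_le_of_isGalois_of_two_le_genus [IsAlgClosed K] [CharZero K]
    [IsAlgFunctionField K F] (F₀ : IntermediateField K F) [FiniteDimensional F₀ F] [IsGalois F₀ F]
    (hg : 2 ≤ genus K F) : Module.finrank F₀ F ≤ 84 * (genus K F - 1) := by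
  haveI : IsAlgFunctionField K F₀ := IsAlgFunctionField.of_intermediateField F₀
  haveI := isIntegrallyClosedIn_of_isAlgClosed (K := K) (F := F)
  haveI := isIntegrallyClosedIn_of_isAlgClosed (K := K) (F := (F₀ : Type v))
  exact AlgFunctionField.finrank_le_of_isGalois_of_two_le_genus (K := K) (F₀ := (F₀ : Type v))
    (F := F)
    PlaceOver.isRational_of_isAlgClosed PlaceOver.isRational_of_isAlgClosed hg

/-- **Hurwitz's theorem `|G| ≤ 84 (g - 1)`.** Let `F/K` be a function field of genus `g ≥ 2` over
an algebraically closed field `K` of characteristic `0`, and `G` a finite group acting faithfully on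
`F` by `K`-algebra automorphisms. Then `|G| ≤ 84 (g - 1)` (Hurwitz 1893): `[F : F^G] = |G|` (Artin,
Mathlib's `FixedPoints.finrank_eq_card`), `F/F^G` is Galois, and
`IntermediateField.finrank_le_of_isGalois_of_two_le_genus` applies to `F^G`.
[cite: Stichtenoth2009, Thm. 3.7.1] -/
theorem card_le_of_faithfulSMul_of_two_le_genus [IsAlgClosed K] [CharZero K]
    [IsAlgFunctionField K F] (G : Type*) [Group G] [Fintype G] [MulSemiringAction G F]
    [FaithfulSMul G F] [SMulCommClass G K F] (hg : 2 ≤ genus K F) :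
    Fintype.card G ≤ 84 * (genus K F - 1) := by
  set F₀ : IntermediateField K F := FixedPoints.intermediateField (F := K) (E := F) G with hF₀
  haveI : FiniteDimensional F₀ F := inferInstanceAs (FiniteDimensional (FixedPoints.subfield G F) F)
  haveI : IsGalois F₀ F := inferInstanceAs (IsGalois (FixedPoints.subfield G F) F)
  have hcard : Module.finrank F₀ F = Fintype.card G := FixedPoints.finrank_eq_card G F
  rw [← hcard]
  exact IntermediateField.finrank_le_of_isGalois_of_two_le_genus F₀ hg

/-- **Hurwitz's theorem for groups of `K`-automorphisms**: every finite subgroup `H` of `Aut_K(F)`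
has `|H| ≤ 84 (g - 1)` when `g = g(F) ≥ 2` (`K` algebraically closed of characteristic `0`).
[cite: Stichtenoth2009, Thm. 3.7.1] -/
theorem card_subgroup_algEquiv_le_of_two_le_genus [IsAlgClosed K] [CharZero K]
    [IsAlgFunctionField K F] (H : Subgroup (F ≃ₐ[K] F)) [Fintype H] (hg : 2 ≤ genus K F) :
    Fintype.card H ≤ 84 * (genus K F - 1) := by
  haveI : FaithfulSMul H F := ⟨fun {σ τ} h ↦ Subtype.ext (AlgEquiv.ext fun x ↦ h x)⟩
  exact card_le_of_faithfulSMul_of_two_le_genus H hg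

end group

end Literature.NumberTheory.DiophantineGeometry.AlgFunctionField

end
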